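import Summits.QuantumFields.BalabanUV.Beta.GAN24.BornLambdaTent
import Summits.QuantumFields.BalabanUV.Beta.GAN24.CubicReadoutDecLift
import Summits.QuantumFields.BalabanUV.Beta.GAN24.SrecLinearPartEq
import Summits.QuantumFields.BalabanUV.Beta.GAN24.Push3LegTelescope
import Summits.QuantumFields.BalabanUV.Beta.GAN24.DilationCovariance
import Summits.QuantumFields.BalabanUV.Beta.GAN24.TaylorLamVertexPairing
import Summits.QuantumFields.BalabanUV.Beta.SpineRootedSc
import Summits.QuantumFields.BalabanUV.Beta.GAN24.KernelLegCharges
import Summits.QuantumFields.BalabanUV.Beta.FP.PerfectTelescopingFinite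
import Summits.QuantumFields.BalabanUV.Beta.GAN24.WilsonSectorUndressedRow

/-!
# `BalabanUV.Beta.GAN24.BornLambdaLift` — binder row G-an2-4 / (CONV-C), CT-ROUTE, `gen20/BORNSEC-PLAN-v1.md` (Λ-U) ∕ `gen20/LAMBDA-U-RECIPE.md`
# STEPS 1–3: **THE UNDRESSED Λ-LINEAGE OF THE COMB FAMILY (E), BORN AT LEVEL `i` AND READ AT LEVEL `k`, IS ROAD S3's ONE-SHOT ROW-Λ OBJECT
# AT THE IN-BLOCK ROOT** — the three-leg push through the (K1b′) response families `respStep (Lc^i) (Lc^k)` of ANY local ff-valued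
# level-`i` family is the ONE-SHOT third-jet functional `e3OfS (Lc^k)` of its contour-summed averaging lift (`DecLiftAdjoint.borderSum`),
# and the lift of the comb Λ-source is an2's ROOTED Lagrange increment `SpineRooted.lagrIncAt ρ`

NOT IN PRINT; OUR BOOKKEEPING (row owner `b2b-balaban-gan24-p1`, gen 21; [folklore] identities over tree theorems BY NAME: the owner's g12
`CubicReadoutDecLift.e3K_borderSum` (decimation–lift exchange), leaf-01's `SrecLinearPartEq.e3K_eq_neg_push₃_of_isFF` and
`Push3LegTelescope.push₃_smul_left ∕ _right ∕ _table ∕ push₃_neg_left`, an4∕an5's `StepDriftWitness.dec_inl_inr` ∕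
`ResolventComposition.dec_inr_inl` ∕ `sum_LegIdx_eq_contourSum` ∕ `GamΦ_eq_neg_wH` (`ℋ♭ = −ℋᵀ`), leaf-09's `DilationCovariance.avgLift_SLam`,
road S3's `TaylorLamVertexPairing.contourSumAdj_mul` ∕ `abs_contourSumAdj_le_exp` and `TaylorLamBracket.lamCoeffOf_KInv_eq_neg_contourSumAdj_shift`,
the owner's g20 `BornLambdaTent.unitS_freshAt_lam_succ_eq_tent`, an2's `SpineRooted.lagrIncAt`).  0 `def`, 0 cited facts, 0 `def … : Prop`,
0 sorry; NO estimate.  HONEST FRAMING (cell contract, verbatim): «discharging `BetaPertH` makes Bałaban's UV stability UNCONDITIONAL — a real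
constructive-QFT result; it is NOT the continuum limit and NOT the Clay problem.»  HONEST DEPENDENCY (verbatim): «continuum YM on T⁴ ⇐ BetaPertH ∧
nine spine estimates (0/9 proved); BetaPertH ⇐ (D1) ∧ (D4) ∧ CAP+tail; G-an2-4 gates asym, D1 and NE2/3/4.»  Discharges NO slot letter (the
letter `hUg` of `BornLambdaLetters.exists_hBLam_of_geometric_three` is the companion `BornLambdaUndressedRow`, conditional on road S3's Λ rows
AT THE IN-BLOCK ROOT); hB OPEN; NEVER «G-an2-4 closed» as (CONV-C); NOT D1, NOT `BetaPertH`, NOT continuum, NOT Clay.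

## What (generic `d`; blockings `M, L ≥ 1`, `N′ = M·L`)
* §1 THE DECIMATED-LEG DICTIONARY: `colH (dec M (KInv N′)) L = (M^{d+2})⁻¹ • respStep M N′`, `rowM (dec M (KInv N′)) L = −((M^{d+2})⁻¹ • respStep M N′)`
  (general-`(M, L)` forms of an5's `KInvStep_inl_inr` ∕ `KInvStep_inr_inl`).
* §2 **`push₃_respStep_eq_e3OfS_borderSum`** — (Λ-U) STEP 2, THE LIFT: for every local ff-valued stencil family `S` on the level-`M` lattice,
  `push₃ (respStep M N′) (respStep M N′) (respStep M N′) S κ′ u′ = e3OfS N′ (((M^{d+2})²) • borderSum M S) κ′ u′` — the undressed three-leg push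
  FROM level `M` IS the one-shot cubic read-out at blocking `N′` of the weight-`(M^{d+2})²` contour-summed averaging lift (at `M = 1` this is the
  owner's g19 `WilsonSectorUndressedRow.e3OfS_eq_push₃`; at `L = Lc`, `M = Lc^j` it is g12's `e3OfK_KInvStep_eq_e3OfS` read through `respStep_eq`).
* §3 THE LIFT OF A Λ-PIECE: `SLam_blocking` (the blocking index of `InterLevelTransport.SLam` is immaterial pointwise), **`borderSum_SLam`**
  (`borderSum M (SLam L c Q2) = SLam N″ (𝒬ᵀ_M c) (avgLift M ∘ Q2)` for coefficients decaying in fine units and bounded tables: the lift sums the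
  coefficient over the `M` contours through the fine bond — `AffineReproduction.contourSumAdj M` — and lifts the tables by `avgLift M`).
* §4 THE INSTANCE (in-block root `ρ = toSite rr`): the tent coefficient of `BornLambdaTent` decays (`abs_tentCoeff_le`), and
  **`borderSum_unitS_freshAt_lam_succ`**: `borderSum (Lc^(j+1)) (unitS_{j+1} (freshAt Lc ρ 0 cΛ (j+1))) κ u
  = (cΛ·((Lc^(j+1))^{2(d+1)})) • lagrIncAt d ρ Lc (Lc^(j+1)) (Lc^(j+2)) κ u` — `𝒬ᵀ_{Lc^(j+1)} ∘ 𝒬ᵀ_{Lc} = 𝒬ᵀ_{Lc^(j+2)}` turns the one-step tent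
  of the unit multiplier kernel `(Lc^(j+1))^{2(d+1)}·wΦ_{Lc^(j+2)}` into road S3's one-shot coefficient `−lamCoeffOf (KInv (Lc^(j+2))) (Lc^(j+2))`.
* §5 THE LINEAGES: **`lineage_succ_eq_e3OfS_lagrIncAt`** (`push₃ (respStep (Lc^(j+1)) (Lc^(j+n+2)))³ (unitS_{j+1} freshAt_{j+1}) = e3OfS (Lc^(j+n+2))
  ((((Lc^(j+1))^{d+2})²·cΛ·(Lc^(j+1))^{2(d+1)}) • lagrIncAt d ρ Lc (Lc^(j+1)) (Lc^(j+2)))`) and **`lineage_zero_eq_e3OfS`** (member `0`: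
  `= e3OfS (Lc^k) (cΛ • SLam Lc (lamCoeffOf (KInv Lc) Lc) H_ρ)`) — road S3's row-Λ ∕ row-Λt ∕ row-Λ0 objects AT THE ROOT `ρ`, up to displayed scalars
  (at `d = 3`, `cE = Lc^4` the weights match road S3's up to the k-free constant `Lc^4`: `BornLambdaUndressedRow`).
Unit `b2b-balaban-gan24-p1` (row owner G-an2-4, gen 21), 2026-08-21.
-/

noncomputable section

open Finset
open scoped BigOperators
open Literature.MathematicalPhysics.QuantumFieldTheory
open Literature.MathematicalPhysics.QuantumFieldTheory.Balaban1983to89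
open Literature.MathematicalPhysics.QuantumFieldTheory.Balaban1983to89.Beta
open LatticeForm (quo)
open B12Sec2to5 (l1 l1_nonneg)
open ExpKernelCalculus (MKer Decays BiLoc l1_natSmul l1_sub_triangle l1_sub_symm summable_exp_shift summable_exp_shift')
open AffineAveraging (box toSite Form1 unitVec)
open AffineReproduction (contourSumAdj)
open KernelSpecInstance (wΦ)
open OneStepResolventKernel (Fib LocStencil KInv decays_KInv KInv_inl_inr_coarse KInv_inr_inl_coarse KInv_inr_inr_coarse quo_zsmul)
open OneStepKernelFamily (dec colH LegIdx legPt)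
open StepDriftWitness (dec_inl_inr sum_LegIdx_eq_contourSum)
open ResolventComposition (dec_inr_inl GamΦ_eq_neg_wH Hcol Hcol_apply)
open BalabanStepJets (lamCoeffOf)
open BalabanCompositeJets (respStep bshift l1_sub_zsmul_quo_le)
open AveragingHessianKernels (ell)
open AveragingHessianKernelsRooted (hessFFAt biLoc_hessFFAt)
open InterLevelTransport (SLam cwsum cwsum_apply avgLift)
open DecLiftAdjoint (borderSum abs_avgLift_le)
open KKTFluctuationEnergy (summable_mul_of_bdd summable_mul_of_bdd')
open Summit.QuantumFields.BalabanUV.Beta.HessKerDressedUnits (unitS)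
open Summit.QuantumFields.BalabanUV.Beta.SpineRooted (lagrIncAt)
open Summit.QuantumFields.BalabanUV.Beta.GAN24.CombesThomas (sfStep smStep)
open Summit.QuantumFields.BalabanUV.Beta.GAN24.Push4 (rowM rowM_apply colH_apply' IsFF)
open Summit.QuantumFields.BalabanUV.Beta.GAN24.Push3 (push₃)
open Summit.QuantumFields.BalabanUV.Beta.GAN24.Push3LegTelescope (push₃_smul_left push₃_smul_right push₃_smul_table push₃_neg_left)
open Summit.QuantumFields.BalabanUV.Beta.GAN24.E3UnitSplit (e3OfS)
open Summit.QuantumFields.BalabanUV.Beta.GAN24.ThirdJetKernel (e3K e3OfS_eq_e3K e3K_smul)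
open Summit.QuantumFields.BalabanUV.Beta.GAN24.CubicReadoutDecLift (e3K_borderSum)
open Summit.QuantumFields.BalabanUV.Beta.GAN24.SrecLinearPartEq (e3K_eq_neg_push₃_of_isFF)
open Summit.QuantumFields.BalabanUV.Beta.GAN24.DilationCovariance (avgLift_SLam)
open Summit.QuantumFields.BalabanUV.Beta.GAN24.TaylorLamVertexPairing (contourSumAdj_mul abs_contourSumAdj_le_exp)
open Summit.QuantumFields.BalabanUV.Beta.GAN24.TaylorLamBracket (lamCoeffOf_KInv_eq_neg_contourSumAdj_shift)
open Summit.QuantumFields.BalabanUV.Beta.GAN24.SrecBornSector (freshAt)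
open Summit.QuantumFields.BalabanUV.Beta.GAN24.BornLambdaTent (unitS_freshAt_lam_succ_eq_tent SLam_const_mul contourSumAdj_const_mul)
open Summit.QuantumFields.BalabanUV.Beta.GAN24.KernelLegCharges (summable_exp_coarse)
open Summit.QuantumFields.BalabanUV.Beta.FP.PerfectTelescopingFinite (contourSumAdj_eq_sum_bshift)
open Summit.QuantumFields.BalabanUV.Beta.GAN24.SrecWilsonSector (isFF_unitS)
open Summit.QuantumFields.BalabanUV.Beta.GAN24.BornLambdaLineage (isFF_freshAt_lam isLoc_unitS_freshAt_lam unitS_freshAt_lam_zero isFF_SLam_hessFFAt)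
open Summit.QuantumFields.BalabanUV.Beta.GAN24.SrecWilsonSector (isFF_smul)
open Summit.QuantumFields.BalabanUV.Beta.GAN24.WilsonSectorUndressedRow (e3OfS_eq_push₃)

namespace Summit.QuantumFields.BalabanUV.Beta.GAN24.BornLambdaLift

variable {d : ℕ}

/-! ## §1 The decimated-leg dictionary: the legs of `dec M (KInv N′)` read at blocking `L` are the response families `respStep M N′` -/

section DecLegs

variable {M L N' : ℕ} [NeZero N']

omit [NeZero N'] in
/-- [folklore] Point bookkeeping: `M•(L•z) = N′•z` for `N′ = M·L`. -/
theorem zsmul_zsmul_eq (hN : N' = M * L) (z : Fin (d + 1) → ℤ) :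
    ((M : ℤ) • ((L : ℤ) • z) : Fin (d + 1) → ℤ) = ((N' : ℕ) : ℤ) • z := by
  rw [smul_smul, hN, Nat.cast_mul]

/-- [folklore] **THE COLUMN LEG OF THE DECIMATED ONE-SHOT RESOLVENT IS THE MEAN-WEIGHT RESPONSE FAMILY**:
`colH (dec M (KInv N′)) L = (M^{d+2})⁻¹ • respStep M N′` (`N′ = M·L`; an4's `dec_inl_inr` + `sum_LegIdx_eq_contourSum` + an5's
`KInv_inl_inr_coarse`; the `(Lc^j, Lc)` case is an5's `KInvStep_inl_inr` ∕ an2's `respStep_eq`). -/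
theorem colH_dec_KInv (hN : N' = M * L) :
    colH (dec M (KInv (N := N') (d := d))) L = ((((M : ℝ) ^ (d + 2))⁻¹) • respStep (d := d) M N') := by
  funext β z' κ z
  rw [colH_apply', Pi.smul_apply, Pi.smul_apply, Pi.smul_apply, Pi.smul_apply, smul_eq_mul, dec_inl_inr]
  congr 1
  unfold BalabanCompositeJets.respStep
  rw [← sum_LegIdx_eq_contourSum]
  refine Finset.sum_congr rfl fun i _ => ?_
  rw [zsmul_zsmul_eq hN, KInv_inl_inr_coarse, Hcol_apply]

/-- [folklore] **THE ROW LEG OF THE DECIMATED ONE-SHOT RESOLVENT IS MINUS THE MEAN-WEIGHT RESPONSE FAMILY** (`ℋ♭ = −ℋᵀ`):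
`rowM (dec M (KInv N′)) L = −((M^{d+2})⁻¹ • respStep M N′)` (`dec_inr_inl`, `KInv_inr_inl_coarse`, `GamΦ_eq_neg_wH`). -/
theorem rowM_dec_KInv (hN : N' = M * L) :
    rowM (dec M (KInv (N := N') (d := d))) L = -((((M : ℝ) ^ (d + 2))⁻¹) • respStep (d := d) M N') := by
  funext α x' κ x
  rw [rowM_apply, Pi.neg_apply, Pi.neg_apply, Pi.neg_apply, Pi.neg_apply, Pi.smul_apply, Pi.smul_apply, Pi.smul_apply, Pi.smul_apply,
    smul_eq_mul, dec_inr_inl, ← mul_neg]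
  congr 1
  unfold BalabanCompositeJets.respStep
  rw [← sum_LegIdx_eq_contourSum, ← Finset.sum_neg_distrib]
  refine Finset.sum_congr rfl fun i _ => ?_
  rw [zsmul_zsmul_eq hN, KInv_inr_inl_coarse, GamΦ_eq_neg_wH, Hcol_apply]

end DecLegs

/-! ## §2 (Λ-U) STEP 2 — the undressed three-leg push from level `M` is the one-shot cubic read-out of the contour-summed averaging lift -/

section Lift

variable {M L N' : ℕ} [NeZero M] [NeZero N']

/-- NOT IN PRINT; OUR BOOKKEEPING ([folklore]).  **THE UNDRESSED Λ∕V-LINEAGE PUSH IS A ONE-SHOT THIRD JET OF THE LIFTED SOURCE**: for every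
LOCAL ff-valued stencil family `S` on the level-`M` lattice and `N′ = M·L`,
`push₃ (respStep M N′) (respStep M N′) (respStep M N′) S κ′ u′ = e3OfS N′ (((M^{d+2})²) • borderSum M S) κ′ u′`.
Mechanism: `e3OfS N′ = e3K (KInv N′) N′` (leaf-05), the decimation–lift exchange `e3K K N′ (borderSum M S) = M^{d+2} • e3K (dec M K) L S`
(the owner's g12 `CubicReadoutDecLift.e3K_borderSum`), `e3K K′ L S = −push₃ (rowM K′ L) (colH K′ L) (colH K′ L) S` on ff-valued families
(leaf-01), the leg dictionary of §1 and the trilinearity of `push₃` in its legs (`Push3LegTelescope`): `M^{2(d+2)}·M^{d+2}·(M^{−(d+2)})³ = 1`,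
the two signs cancel. -/
theorem push₃_respStep_eq_e3OfS_borderSum (hN : N' = M * L) {S : Fin (d + 1) → (Fin (d + 1) → ℤ) → MKer (d + 1) (Fib d)} {Cs δ : ℝ}
    (hS : LocStencil S Cs δ) (hδ : 0 < δ) (hff : ∀ κ u, IsFF (S κ u)) (κ' : Fin (d + 1)) (u' : Fin (d + 1) → ℤ) :
    push₃ (respStep (d := d) M N') (respStep (d := d) M N') (respStep (d := d) M N') S κ' u'
      = e3OfS N' (fun κ u => ((((M : ℝ) ^ (d + 2)) ^ 2)) • borderSum M S κ u) κ' u' := by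
  obtain ⟨δK, CK, hδK, -, hK⟩ := decays_KInv (N := N') (d := d)
  have hM : ((M : ℝ) ^ (d + 2)) ≠ 0 := pow_ne_zero _ (by exact_mod_cast NeZero.ne M)
  rw [e3OfS_eq_e3K, e3K_smul, e3K_borderSum (L := L) hK hδK hS hδ hN κ' u', e3K_eq_neg_push₃_of_isFF _ _ hff, rowM_dec_KInv hN,
    colH_dec_KInv hN, push₃_neg_left, neg_neg, push₃_smul_left, push₃_smul_right, push₃_smul_table, smul_smul, smul_smul, smul_smul,
    smul_smul]
  rw [show ((M : ℝ) ^ (d + 2)) ^ 2 * (M : ℝ) ^ (d + 2) * (((M : ℝ) ^ (d + 2))⁻¹) * (((M : ℝ) ^ (d + 2))⁻¹) * (((M : ℝ) ^ (d + 2))⁻¹)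
      = 1 by field_simp, one_smul]

end Lift

/-! ## §3 The contour-summed averaging lift of a Λ-piece -/

section LamPiece

/-- [folklore] The blocking index of `InterLevelTransport.SLam` is immaterial pointwise (`cwsum_apply`): `SLam N₁ c Q2 = SLam N₂ c Q2`. -/
theorem SLam_blocking (N₁ N₂ : ℕ) [NeZero N₁] [NeZero N₂]
    (c : Fin (d + 1) → (Fin (d + 1) → ℤ) → Fin (d + 1) → (Fin (d + 1) → ℤ) → ℝ)
    (Q2 : Fin (d + 1) → (Fin (d + 1) → ℤ) → MKer (d + 1) (Fib d)) : SLam N₁ c Q2 = SLam N₂ c Q2 := by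
  funext κ u x z a b
  simp only [SLam, cwsum_apply]

variable {M L : ℕ} [NeZero M] [NeZero L]

/-- NOT IN PRINT; OUR BOOKKEEPING ([folklore]).  **THE CONTOUR-SUMMED AVERAGING LIFT OF A Λ-PIECE IS A Λ-PIECE**: for conversion coefficients
decaying in fine units from the perturbed bond (`|c μ y κ′ u| ≤ C·e^{−δ|L•y − u|₁}`) and bounded curvature tables,
`borderSum M (SLam L c Q2) = SLam N″ (fun μ y κ u ↦ 𝒬ᵀ_M (c μ y) κ u) (fun μ y ↦ avgLift M (Q2 μ y))` — the table index is summed over the `M`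
straight contours through the fine bond (`AffineReproduction.contourSumAdj M`, via leaf-06's `contourSumAdj_eq_sum_bshift`), the curvature tables
are lifted by `avgLift M` (leaf-09's `DilationCovariance.avgLift_SLam`); the finite contour sum is exchanged with the coarse superposition termwise. -/
theorem borderSum_SLam (N'' : ℕ) [NeZero N''] {c : Fin (d + 1) → (Fin (d + 1) → ℤ) → Fin (d + 1) → (Fin (d + 1) → ℤ) → ℝ}
    {C δ : ℝ} (hc : ∀ μ y κ' u, |c μ y κ' u| ≤ C * Real.exp (-δ * l1 ((L : ℤ) • y - u))) (hδ : 0 < δ)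
    {Q2 : Fin (d + 1) → (Fin (d + 1) → ℤ) → MKer (d + 1) (Fib d)} {CQ : ℝ} (hQ : ∀ μ y x z a b, |Q2 μ y x z a b| ≤ CQ) :
    borderSum M (SLam L c Q2) = SLam N'' (fun μ y κ u => contourSumAdj M (c μ y) κ u) (fun μ y => avgLift M (Q2 μ y)) := by
  have hL : 1 ≤ L := Nat.one_le_iff_ne_zero.2 (NeZero.ne L)
  funext κ u x w a b
  -- the lift passes through the Λ-piece (leaf-09), contour by contour
  have e1 : borderSum M (SLam L c Q2) κ u x w a b
      = ∑ s ∈ Finset.range M, SLam L c (fun μ y => avgLift M (Q2 μ y)) κ (quo M (u - bshift d κ s)) x w a b := by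
    simp only [borderSum]
    refine Finset.sum_congr rfl fun s _ => ?_
    rw [avgLift_SLam M L hc hδ hQ]
  rw [e1]
  simp only [SLam, cwsum_apply, contourSumAdj_eq_sum_bshift, Finset.sum_neg_distrib, Finset.sum_mul]
  congr 1
  rw [Finset.sum_comm]
  refine Finset.sum_congr rfl fun μ _ => ?_
  -- exchange the finite contour sum with the coarse superposition
  have hs : ∀ s ∈ Finset.range M, Summable fun y => c μ y κ (quo M (u - bshift d κ s)) * avgLift M (Q2 μ y) x w a b := by
    intro s _
    have h1 : Summable fun y => c μ y κ (quo M (u - bshift d κ s)) :=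
      Summable.of_norm_bounded ((summable_exp_coarse hL hδ _).mul_left C) fun y => by
        rw [Real.norm_eq_abs]; exact hc μ y κ _
    exact summable_mul_of_bdd' h1 fun y => abs_avgLift_le M (hQ μ y) x w a b
  rw [← Summable.tsum_finsetSum hs]

end LamPiece

/-! ## §4 The instance: the lift of the comb Λ-source is an2's ROOTED Lagrange increment -/

section Instance

variable {Lc : ℕ} [NeZero Lc]

/-- [folklore] Fine-unit form of a coarse decay: `e^{−δ|quo L u − y|₁} ≤ e^{δ(d+1)}·e^{−(δ/L)|L•y − u|₁}` (`|u − L•quo L u|₁ ≤ (d+1)·L`). -/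
theorem exp_quo_le_exp_fine (L : ℕ) [NeZero L] {δ : ℝ} (hδ : 0 ≤ δ) (y u : Fin (d + 1) → ℤ) :
    Real.exp (-δ * l1 (quo L u - y)) ≤ Real.exp (δ * ((d : ℝ) + 1)) * Real.exp (-(δ / L) * l1 ((L : ℤ) • y - u)) := by
  have hL0 : (0 : ℝ) < L := by exact_mod_cast Nat.pos_of_ne_zero (NeZero.ne L)
  rw [← Real.exp_add, Real.exp_le_exp]
  -- `|L•y − u|₁ ≤ L·|y − quo u|₁ + |L•quo u − u|₁ ≤ L·|quo u − y|₁ + (d+1)·L`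
  have h1 : l1 ((L : ℤ) • y - u) ≤ l1 ((L : ℤ) • y - (L : ℤ) • quo L u) + l1 ((L : ℤ) • quo L u - u) := l1_sub_triangle _ _ _
  have h2 : l1 ((L : ℤ) • y - (L : ℤ) • quo L u) = (L : ℝ) * l1 (quo L u - y) := by
    rw [← smul_sub, l1_natSmul, l1_sub_symm]
  have h3 : l1 ((L : ℤ) • quo L u - u) ≤ ((d : ℝ) + 1) * L := by
    rw [l1_sub_symm]; exact_mod_cast l1_sub_zsmul_quo_le L u
  have h5 : l1 ((L : ℤ) • y - u) ≤ (L : ℝ) * l1 (quo L u - y) + ((d : ℝ) + 1) * L := by rw [h2] at h1; linarith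
  have h4 : δ / L * l1 ((L : ℤ) • y - u) ≤ δ * l1 (quo L u - y) + δ * ((d : ℝ) + 1) := by
    have h6 := mul_le_mul_of_nonneg_left h5 (div_nonneg hδ hL0.le)
    have e : δ / L * ((L : ℝ) * l1 (quo L u - y) + ((d : ℝ) + 1) * L) = δ * l1 (quo L u - y) + δ * ((d : ℝ) + 1) := by
      field_simp
    linarith [e]
  linarith

/-- [folklore] **THE TENT COEFFICIENT OF THE COMB Λ-SOURCE DECAYS IN FINE UNITS** from the perturbed bond (for the Fubini of §3; per-level
constants — only SOME decay is needed): for every scalar `E`,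
`|𝒬ᵀ_{Lc}[E·wΦ_{N′}(·; μ, · − y)](κ′, u)| ≤ C·e^{−δ|Lc•y − u|₁}` with `(C, δ)` from `decays_KInv (N := N′)`. -/
theorem abs_tentCoeff_le (N' : ℕ) [NeZero N'] (E : ℝ) :
    ∃ C δ : ℝ, 0 < δ ∧ ∀ (μ : Fin (d + 1)) (y : Fin (d + 1) → ℤ) (κ' : Fin (d + 1)) (u : Fin (d + 1) → ℤ),
      |contourSumAdj Lc (fun κ'' y'' => E * wΦ (N := N') (d := d) κ'' μ (y'' - y)) κ' u| ≤
        C * Real.exp (-δ * l1 ((Lc : ℤ) • y - u)) := by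
  obtain ⟨δK, CK, hδK, hCK, hK⟩ := decays_KInv (N := N') (d := d)
  have hL0 : (0 : ℝ) < Lc := by exact_mod_cast Nat.pos_of_ne_zero (NeZero.ne Lc)
  refine ⟨(Lc : ℝ) * (|E| * CK * Real.exp δK) * Real.exp (δK * ((d : ℝ) + 1)), δK / Lc, div_pos hδK hL0, fun μ y κ' u => ?_⟩
  -- the coarse decay of the multiplier kernel from the decay of the packed resolvent
  have hφ : ∀ (κ'' : Fin (d + 1)) (y'' : Fin (d + 1) → ℤ), |E * wΦ (N := N') (d := d) κ'' μ (y'' - y)| ≤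
      |E| * CK * Real.exp (-δK * l1 (y'' - y)) := by
    intro κ'' y''
    rw [abs_mul, mul_assoc]
    refine mul_le_mul_of_nonneg_left ?_ (abs_nonneg _)
    have h := hK ((N' : ℤ) • y'') ((N' : ℤ) • y) (Sum.inr κ'') (Sum.inr μ)
    rw [KInv_inr_inr_coarse, ← smul_sub, l1_natSmul] at h
    refine h.trans (mul_le_mul_of_nonneg_left (Real.exp_le_exp.2 ?_) hCK)
    have hN1 : (1 : ℝ) ≤ N' := by exact_mod_cast Nat.one_le_iff_ne_zero.2 (NeZero.ne N')
    have h7 : δK * l1 (y'' - y) ≤ δK * ((N' : ℝ) * l1 (y'' - y)) :=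
      mul_le_mul_of_nonneg_left (le_mul_of_one_le_left (l1_nonneg _) hN1) hδK.le
    linarith
  refine (abs_contourSumAdj_le_exp Lc _ y hδK.le hφ κ' u).trans ?_
  have h2 := exp_quo_le_exp_fine (d := d) Lc hδK.le y u
  have hpos : 0 ≤ (Lc : ℝ) * (|E| * CK * Real.exp δK) := by positivity
  calc (Lc : ℝ) * (|E| * CK * Real.exp δK * Real.exp (-δK * l1 (quo Lc u - y)))
      = (Lc : ℝ) * (|E| * CK * Real.exp δK) * Real.exp (-δK * l1 (quo Lc u - y)) := by ring
    _ ≤ (Lc : ℝ) * (|E| * CK * Real.exp δK) * (Real.exp (δK * ((d : ℝ) + 1)) * Real.exp (-(δK / Lc) * l1 ((Lc : ℤ) • y - u))) :=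
        mul_le_mul_of_nonneg_left h2 hpos
    _ = _ := by ring

omit [NeZero Lc] in
/-- [folklore] The rooted one-step constraint Hessian is bounded by `2ℓ²` (an1's `biLoc_hessFFAt` at rate `0`, in-block root). -/
theorem abs_hessFFAt_le (hLc : 1 ≤ Lc) {rr : Fin (d + 1) → ℕ} (hrr : rr ∈ box (d + 1) Lc) (μ : Fin (d + 1)) (y x z : Fin (d + 1) → ℤ)
    (a b : Fib d) : |hessFFAt (toSite rr) Lc μ y x z a b| ≤ 2 * (ell (d + 1) Lc : ℝ) ^ 2 := by
  have h := biLoc_hessFFAt hLc μ y hrr le_rfl x z a b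
  simp only [mul_zero, neg_zero, zero_mul, Real.exp_zero, mul_one] at h
  exact h

/-- NOT IN PRINT; OUR BOOKKEEPING ([folklore]; (Λ-U) STEPS 1+3).  **THE CONTOUR-SUMMED AVERAGING LIFT OF THE COMB Λ-SOURCE OF MEMBER `j+1` IS
an2's ROOTED LAGRANGE INCREMENT WITH THE WEIGHT `cΛ·(Lc^(j+1))^{2(d+1)}`**:
`borderSum (Lc^(j+1)) (unitS_{j+1} (freshAt Lc ρ 0 cΛ (j+1))) κ u = (cΛ·(Lc^(j+1))^{2(d+1)}) • lagrIncAt d ρ Lc (Lc^(j+1)) (Lc^(j+2)) κ u`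
(in-block root).  Mechanism: the source is `(−cΛ) • S^Λ[𝒬ᵀ_{Lc}Ê_{j+2}]` (`BornLambdaTent`), its lift is `S^Λ[𝒬ᵀ_{Lc^(j+1)}𝒬ᵀ_{Lc}Ê_{j+2}]` over the lifted
tables (§3), `𝒬ᵀ_{Lc^(j+1)}𝒬ᵀ_{Lc} = 𝒬ᵀ_{Lc^(j+2)}` (road S3's `contourSumAdj_mul`) and `𝒬ᵀ_{Lc^(j+2)}[wΦ_{Lc^(j+2)}(·; μ, · − y)] = −lamCoeffOf (KInv _) _ μ y`
(road S3's `lamCoeffOf_KInv_eq_neg_contourSumAdj_shift`): the two signs cancel and the unit factor `(Lc^(j+1))^{2(d+1)}` of `Ê_{j+2}` stays. -/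
theorem borderSum_unitS_freshAt_lam_succ (hLc : 1 ≤ Lc) {rr : Fin (d + 1) → ℕ} (hrr : rr ∈ box (d + 1) Lc) (cΛ : ℝ) (j : ℕ)
    (κ : Fin (d + 1)) (u : Fin (d + 1) → ℤ) :
    borderSum (Lc ^ (j + 1)) (unitS (sfStep Lc (j + 1)) (smStep d Lc (j + 1)) (freshAt Lc (toSite rr) 0 cΛ (j + 1))) κ u
      = (cΛ * ((Lc : ℝ) ^ (j + 1)) ^ (2 * (d + 1))) • lagrIncAt d (toSite rr) Lc (Lc ^ (j + 1)) (Lc ^ (j + 1 + 1)) κ u := by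
  set E : ℝ := ((Lc : ℝ) ^ (j + 1)) ^ (2 * (d + 1)) with hE
  -- the source as ONE Λ-piece with the weight inside the coefficient
  have e0 : unitS (sfStep Lc (j + 1)) (smStep d Lc (j + 1)) (freshAt Lc (toSite rr) 0 cΛ (j + 1))
      = SLam Lc (fun μ y κ' u' => (-cΛ) *
          contourSumAdj Lc (fun κ'' y'' => E * wΦ (N := Lc ^ (j + 2)) (d := d) κ'' μ (y'' - y)) κ' u')
          (fun μ y => hessFFAt (toSite rr) Lc μ y) := by
    rw [unitS_freshAt_lam_succ_eq_tent]
    funext κ' u'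
    rw [SLam_const_mul]
  -- decay of the coefficient, boundedness of the tables
  obtain ⟨C, δ, hδ, hc⟩ := abs_tentCoeff_le (d := d) (Lc := Lc) (Lc ^ (j + 2)) E
  have hc' : ∀ (μ : Fin (d + 1)) (y : Fin (d + 1) → ℤ) (κ' : Fin (d + 1)) (u' : Fin (d + 1) → ℤ),
      |(-cΛ) * contourSumAdj Lc (fun κ'' y'' => E * wΦ (N := Lc ^ (j + 2)) (d := d) κ'' μ (y'' - y)) κ' u'|
        ≤ |cΛ| * C * Real.exp (-δ * l1 ((Lc : ℤ) • y - u')) := by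
    intro μ y κ' u'
    rw [abs_mul, abs_neg, mul_assoc]
    exact mul_le_mul_of_nonneg_left (hc μ y κ' u') (abs_nonneg _)
  rw [e0, borderSum_SLam (M := Lc ^ (j + 1)) (L := Lc) (Lc ^ (j + 1 + 1)) hc' hδ (fun μ y x z a b => abs_hessFFAt_le hLc hrr μ y x z a b)]
  -- the lifted coefficient is `(cΛ·E) · lamCoeffOf (KInv (Lc^(j+2))) (Lc^(j+2))`
  have e1 : (fun μ y κ' u' => contourSumAdj (Lc ^ (j + 1)) (fun κ₁ u₁ => (-cΛ) *
        contourSumAdj Lc (fun κ'' y'' => E * wΦ (N := Lc ^ (j + 2)) (d := d) κ'' μ (y'' - y)) κ₁ u₁) κ' u')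
      = fun μ y κ' u' => (cΛ * E) * lamCoeffOf (KInv (N := Lc ^ (j + 1 + 1)) (d := d)) (Lc ^ (j + 1 + 1)) μ y κ' u' := by
    funext μ y κ' u'
    rw [contourSumAdj_const_mul, ← congrFun (congrFun (contourSumAdj_mul (Lc ^ (j + 1)) Lc _) κ') u', ← pow_succ,
      contourSumAdj_const_mul, lamCoeffOf_KInv_eq_neg_contourSumAdj_shift]
    ring
  rw [e1, SLam_const_mul]
  rfl

end Instance

/-! ## §5 The undressed Λ-lineages of the comb family as one-shot third jets of rooted Λ-pieces (generic `d`, in-block root) -/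

section Lineage

variable {Lc : ℕ} [NeZero Lc]

/-- NOT IN PRINT; OUR BOOKKEEPING ([folklore]; (Λ-U) STEPS 1–3 for the members `j+1`).  **THE UNDRESSED Λ-LINEAGE BORN AT LEVEL `j+1` AND READ
AT LEVEL `j+n+2` IS THE ONE-SHOT THIRD JET OF an2's ROOTED LAGRANGE INCREMENT**:
`push₃ B B B (unitS_{j+1} (freshAt Lc ρ 0 cΛ (j+1))) κ′ u′ = e3OfS (Lc^(j+n+2)) ((((Lc^(j+1))^{d+2})²·cΛ·(Lc^(j+1))^{2(d+1)}) • lagrIncAt d ρ Lc (Lc^(j+1)) (Lc^(j+2))) κ′ u′`,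
`B = respStep (Lc^(j+1)) (Lc^(j+n+2))` (§2 at `M = Lc^(j+1)`, `L = Lc^(n+1)` + §4) — road S3's row-Λ object (`TaylorRowLam.rowL_three` ∕ `TaylorRowLamTop.rowLamTop`:
`e3OfS (Lc^(n′+2)) (… • lagrInc 3 Lc (Lc^(m+1)) (Lc^(m+2)))`, `m = j`, `n′ = j+n`) AT THE ROOT `ρ`, up to the displayed scalar. -/
theorem lineage_succ_eq_e3OfS_lagrIncAt (hLc : 1 ≤ Lc) {rr : Fin (d + 1) → ℕ} (hrr : rr ∈ box (d + 1) Lc) (cΛ : ℝ) (j n : ℕ)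
    (κ' : Fin (d + 1)) (u' : Fin (d + 1) → ℤ) :
    push₃ (respStep (d := d) (Lc ^ (j + 1)) (Lc ^ (j + n + 1 + 1))) (respStep (d := d) (Lc ^ (j + 1)) (Lc ^ (j + n + 1 + 1)))
        (respStep (d := d) (Lc ^ (j + 1)) (Lc ^ (j + n + 1 + 1)))
        (unitS (sfStep Lc (j + 1)) (smStep d Lc (j + 1)) (freshAt Lc (toSite rr) 0 cΛ (j + 1))) κ' u'
      = e3OfS (Lc ^ (j + n + 1 + 1)) (fun κ u => ((((Lc : ℝ) ^ (j + 1)) ^ (d + 2)) ^ 2 * (cΛ * ((Lc : ℝ) ^ (j + 1)) ^ (2 * (d + 1)))) •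
          lagrIncAt d (toSite rr) Lc (Lc ^ (j + 1)) (Lc ^ (j + 1 + 1)) κ u) κ' u' := by
  obtain ⟨Cs, δ, hδ, hS⟩ := isLoc_unitS_freshAt_lam hrr 0 cΛ (j + 1) (sfStep Lc (j + 1)) (smStep d Lc (j + 1))
  have hff : ∀ κ u, IsFF (unitS (sfStep Lc (j + 1)) (smStep d Lc (j + 1)) (freshAt Lc (toSite rr) 0 cΛ (j + 1)) κ u) :=
    fun κ u => isFF_unitS (isFF_freshAt_lam (toSite rr) cΛ (j + 1)) _ _ κ u
  have hN : Lc ^ (j + n + 1 + 1) = Lc ^ (j + 1) * Lc ^ (n + 1) := by rw [← pow_add, show j + n + 1 + 1 = j + 1 + (n + 1) by omega]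
  rw [push₃_respStep_eq_e3OfS_borderSum (M := Lc ^ (j + 1)) (L := Lc ^ (n + 1)) hN hS hδ hff]
  have hF : (fun κ u => ((((Lc ^ (j + 1) : ℕ) : ℝ) ^ (d + 2)) ^ 2) •
        borderSum (Lc ^ (j + 1)) (unitS (sfStep Lc (j + 1)) (smStep d Lc (j + 1)) (freshAt Lc (toSite rr) 0 cΛ (j + 1))) κ u)
      = fun κ u => ((((Lc : ℝ) ^ (j + 1)) ^ (d + 2)) ^ 2 * (cΛ * ((Lc : ℝ) ^ (j + 1)) ^ (2 * (d + 1)))) •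
          lagrIncAt d (toSite rr) Lc (Lc ^ (j + 1)) (Lc ^ (j + 1 + 1)) κ u := by
    funext κ u
    rw [borderSum_unitS_freshAt_lam_succ hLc hrr cΛ j κ u, smul_smul, Nat.cast_pow]
  rw [hF]

/-- NOT IN PRINT; OUR BOOKKEEPING ([folklore]; the member `0`).  **THE UNDRESSED Λ-LINEAGE BORN AT LEVEL `0` AND READ AT LEVEL `k` IS THE ONE-SHOT THIRD
JET OF THE ROOTED ONE-STEP Λ-PIECE**: `push₃ B B B (unitS_0 (freshAt Lc ρ 0 cΛ 0)) κ′ u′ = e3OfS (Lc^k) (cΛ • SLam Lc (lamCoeffOf (KInv Lc) Lc) H_ρ) κ′ u′`,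
`B = respStep (Lc^0) (Lc^k) = respStep 1 (Lc^k)` (leaf-01's `unitS_freshAt_lam_zero` + the owner's g19 `WilsonSectorUndressedRow.e3OfS_eq_push₃`) —
road S3's row-Λ0 object (`S3ShapeL0.rowL0_holds`: `e3OfS (Lc^(n+2)) (… • SLam Lc (lamCoeffOf (KInv Lc) Lc) (hessFF Lc))`) AT THE ROOT `ρ`, up to the scalar. -/
theorem lineage_zero_eq_e3OfS (ρ : Fin (d + 1) → ℤ) (cΛ : ℝ) (k : ℕ) (κ' : Fin (d + 1)) (u' : Fin (d + 1) → ℤ) :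
    push₃ (respStep (d := d) (Lc ^ 0) (Lc ^ k)) (respStep (d := d) (Lc ^ 0) (Lc ^ k)) (respStep (d := d) (Lc ^ 0) (Lc ^ k))
        (unitS (sfStep Lc 0) (smStep d Lc 0) (freshAt Lc ρ 0 cΛ 0)) κ' u'
      = e3OfS (Lc ^ k) (fun κ u => cΛ • SLam Lc (lamCoeffOf (KInv (N := Lc) (d := d)) Lc) (fun μ y => hessFFAt ρ Lc μ y) κ u) κ' u' := by
  have hff : ∀ κ u, IsFF ((fun κ u => cΛ • SLam Lc (lamCoeffOf (KInv (N := Lc) (d := d)) Lc) (fun μ y => hessFFAt ρ Lc μ y) κ u) κ u) :=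
    fun κ u => isFF_smul (isFF_SLam_hessFFAt ρ Lc _ κ u) cΛ
  rw [pow_zero, unitS_freshAt_lam_zero, e3OfS_eq_push₃ hff]

end Lineage

end Summit.QuantumFields.BalabanUV.Beta.GAN24.BornLambdaLift

end
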